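import Literature.AlgebraicGeometry.AbelianSchemes.AbelianSchemeQuotientPoincarePullback
import Literature.AlgebraicGeometry.AbelianSchemes.AbelianSchemeQuotientDualSideAction
import Literature.AlgebraicGeometry.AbelianSchemes.RigidDescentAlongUnitSection
import Literature.AlgebraicGeometry.AbelianSchemes.AbelianSchemeBaseChangeComp
import Literature.AlgebraicGeometry.AbelianSchemes.RigidifiedLineBundleComap
import HarnessLib

/-!
# The normalised `K′`-equivariant structure on `𝒩₁ = (π × 1)^*𝒫` (dual pair of the quotient `A/K`, step D3b)

Layer `Literature/AlgebraicGeometry/AbelianSchemes`, namespace `Literature.AlgebraicGeometry.AbelianSchemes.AbelianSchemeOver`.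
ONE definition with body (`poincareStabilizerStructure`, DATA: a `G`-linearisation) and theorems; no `def … : Prop`, no named
fact, no instance.

Setting of ★ `AbelianSchemeQuotientPoincarePullback` ((ii) part 1) and ★ `AbelianSchemeQuotientDualSideAction` (D3a): `B := A/K`
(★ `quotientBy`), the dual abelian scheme `Â = D.hat` of a dual pair `D`, the rigidified fibrewise-`Pic⁰` family
`𝒩₁ = (π × 1)^*𝒫` on `B ×_S Â` over `Â` (★ `poincarePullbackBundle`, `poincarePullback`), the `K′`-translation action
`ρ = 1 × t_•` on `B ×_S Â` (★ `prodTranslationActionOver`) for a finite subgroup `K′ ≤ Â(S)` contained in the STABILISER of `𝒩₁`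
(★ `poincareStabilizerSubgroup`: `(1 × t_k)^*𝒩₁ ≅ 𝒩₁` for `k ∈ K′`), and the translation action `τ = t_•` on `Â` (★
`translationActionOver`).  Over a REDUCED locally Noetherian `Â`:

* §1 `translation_comp_unitSection_baseChange` — the unit section `ε : Â → B ×_S Â` is equivariant: `t_k ≫ ε = ε ≫ (1 × t_k)`.
* §2 `exists_poincareStabilizerStructure` — a `K′`-linearisation of `𝒩₁` restricting along `ε` to the TRIVIAL
  `K′`-linearisation of `ε^*𝒩₁ ≅ 𝒪_Â = (Â → Y)^*𝒪_Y` (★ `EquivariantStructure.ofPullback`, ★ `ofIso`, ★ `pullbackUnitIso`, the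
  rigidification of `𝒩₁`; spelled out inline, no auxiliary definition) EXISTS (★ `exists_equivariantStructure_of_restrictAlong_unitSection`).
* §3 **`poincareStabilizerStructure … (hK′ : K′ ≤ poincareStabilizerSubgroup …) : ρ.EquivariantStructure 𝒩₁`** — THE NORMALISED
  `K′`-EQUIVARIANT STRUCTURE ON `𝒩₁`: the unique `K′`-linearisation of `𝒩₁` for `1 × t_•` whose restriction along `ε` is the
  trivial linearisation of `ε^*𝒩₁ ≅ 𝒪_Â` (★ `exists_equivariantStructure_of_restrictAlong_unitSection` = Mumford's normalisation
  along `{0} × X` in families, [MumfordAV1970] §8 pp. 78–80 / §23); `poincareStabilizerStructure_restrictAlong` (its normalisation)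
  and `poincareStabilizerStructure_unique`.  Its `iso_one_hom` / `iso_mul_hom` ARE the `hunit` / `hcocycle` inputs of ★ T1
  `ActionOver.exists_descent_of_free` / `isIso_descentHom` for the descent of `𝒩₁` to `B ×_S (Â/K′)` (step D4, B-p20 (g9)).

Cell `hodgecm-mathlib` (D-0151), HECKE-LINK H2 file (ii) «dual pair of the quotient» (B-p20 (g9) hand D3b 20:47:30Z / 20:51:36Z).
Count-neutral; HC_CM is proved only modulo the 7 printed citations until rung 0 closes.

## References
* [MumfordAV1970] D. Mumford, *Abelian Varieties* (1970), §8 pp. 78–80, §15 Thm. 1 (p. 143), §23 (p. 231).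
* [MumfordFogartyKirwan1994] D. Mumford, J. Fogarty, F. Kirwan, *GIT* 3rd ed. (1994), Ch. 1 §3 Def. 1.6 (p. 30).
* [MilneAV2008] J. S. Milne, *Abelian Varieties* (v2.00, 2008), I §8 p. 40, I §9 Thm. 9.1 (p. 42).
-/

set_option autoImplicit false

noncomputable section

universe u

open CategoryTheory CategoryTheory.Limits AlgebraicGeometry MonoidalCategory
open Literature.AlgebraicGeometry.RelativeSpec Literature.AlgebraicGeometry.Modules Literature.AlgebraicGeometry.Motives
open scoped MonObj

namespace Literature.AlgebraicGeometry.AbelianSchemes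

namespace AbelianSchemeOver

variable {S : Scheme.{u}} (A : AbelianSchemeOver S)
  {Y : Scheme.{u}} (u : S ⟶ Y) (K : Subgroup A.Sections) [IsCommMonObj A.X] {n : ℕ}
  (hK : ∀ σ : K, (σ : A.Sections) ^ n = 1)
  [Finite K] [Y.IsSeparated] [IsSeparated (A.X.hom ≫ u)] [S.IsSeparated]
  (hcov : ∀ x : A.left, ∃ O : (A.translationActionOver u K).StableAffineOpens, x ∈ O.1)
  [LocallyOfFiniteType (A.X.hom ≫ u)] [IsLocallyNoetherian Y]
  (hG : ∃ _ : GrpObj (A.quotientOver u K), IsMonHom (A.quotientMk u K hcov))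
  (hsm : Smooth (A.quotientOver u K).hom) (hgc : GeometricallyConnected (A.quotientOver u K).hom)
  (D : A.DualPair) [IsAffine Y]
  (hfree : ∀ (Ω : Type u) [Field Ω] [IsAlgClosed Ω] (x : Spec (.of Ω) ⟶ A.left) (σ : K), σ ≠ 1 →
    x ≫ (A.translation (σ : A.Sections)).left ≠ x)
  (K' : Subgroup D.hat.Sections) [Finite K'] [IsSeparated (D.hat.X.hom ≫ u)]
  (hcov' : ∀ x : D.hat.left, ∃ O : (D.hat.translationActionOver u K').StableAffineOpens, x ∈ O.1)

/-! ## §1 The unit section of `B ×_S Â → Â` is `K′`-equivariant -/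

omit [IsCommMonObj A.X] [IsSeparated (A.X.hom ≫ u)] [LocallyOfFiniteType (A.X.hom ≫ u)] [IsLocallyNoetherian Y]
  [IsAffine Y] in
/-- **`t_k ≫ ε = ε ≫ (1 × t_k)`**: the unit section `ε = (e_B, id) : Â → B ×_S Â` of the base-changed abelian scheme
`B_Â` intertwines the translation `t_k` of `Â` with `1 × t_k` (both projections agree: ★ `unitSection_baseChange_comp_fst`,
★ `prodTranslationActionOver_aut_hom_fst/snd`). [cite: MumfordAV1970, §8 (pp. 78–80)] -/
theorem translation_comp_unitSection_baseChange (B : AbelianSchemeOver S) (k : K') :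
    (D.hat.translationActionOver u K').autHom k ≫ (B.baseChange D.hat.X.hom).unitSection =
      (B.baseChange D.hat.X.hom).unitSection ≫ (B.prodTranslationActionOver D.hat u K' hcov').autHom k := by
  -- the unit section, typed into Mathlib's `pullback` (definitionally the carrier of `B_Â` and of `B ⊗ Â`)
  let ε' : D.hat.X.left ⟶ pullback B.X.hom D.hat.X.hom := (B.baseChange D.hat.X.hom).unitSection
  have hk : (D.hat.translationActionOver u K').autHom k = (D.hat.translation (k : D.hat.Sections)).left :=
    D.hat.translationActionOver_aut_hom u K' k
  have e1 : ε' ≫ pullback.fst B.X.hom D.hat.X.hom = D.hat.X.hom ≫ B.unitSection :=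
    B.unitSection_baseChange_comp_fst D.hat.X.hom
  have e2 : ε' ≫ pullback.snd B.X.hom D.hat.X.hom = 𝟙 _ := (B.baseChange D.hat.X.hom).unitSection_comp_hom
  have e3 : (D.hat.translation (k : D.hat.Sections)).left ≫ D.hat.X.hom = D.hat.X.hom :=
    Over.w (D.hat.translation (k : D.hat.Sections))
  have f1 := B.prodTranslationActionOver_aut_hom_fst D.hat u K' hcov' k
  have f2 := B.prodTranslationActionOver_aut_hom_snd D.hat u K' hcov' k
  change (D.hat.translationActionOver u K').autHom k ≫ ε' =
    ε' ≫ ((B.prodTranslationActionOver D.hat u K' hcov').aut k).hom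
  apply pullback.hom_ext
  · calc ((D.hat.translationActionOver u K').autHom k ≫ ε') ≫ pullback.fst B.X.hom D.hat.X.hom
          = (D.hat.translationActionOver u K').autHom k ≫ (ε' ≫ pullback.fst B.X.hom D.hat.X.hom) :=
            Category.assoc _ _ _
      _ = ((D.hat.translation (k : D.hat.Sections)).left ≫ D.hat.X.hom) ≫ B.unitSection := by
            rw [e1, hk]; exact (Category.assoc _ _ _).symm
      _ = ε' ≫ pullback.fst B.X.hom D.hat.X.hom := by rw [e3]; exact e1.symm
      _ = ε' ≫ (((B.prodTranslationActionOver D.hat u K' hcov').aut k).hom ≫ pullback.fst B.X.hom D.hat.X.hom) :=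
            (congrArg (fun x => ε' ≫ x) f1).symm
      _ = (ε' ≫ ((B.prodTranslationActionOver D.hat u K' hcov').aut k).hom) ≫ pullback.fst B.X.hom D.hat.X.hom :=
            (Category.assoc _ _ _).symm
  · calc ((D.hat.translationActionOver u K').autHom k ≫ ε') ≫ pullback.snd B.X.hom D.hat.X.hom
          = (D.hat.translationActionOver u K').autHom k ≫ (ε' ≫ pullback.snd B.X.hom D.hat.X.hom) :=
            Category.assoc _ _ _
      _ = (D.hat.translation (k : D.hat.Sections)).left := by rw [e2, hk]; exact Category.comp_id _
      _ = (ε' ≫ pullback.snd B.X.hom D.hat.X.hom) ≫ (D.hat.translation (k : D.hat.Sections)).left := by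
            rw [e2]; exact (Category.id_comp _).symm
      _ = ε' ≫ (((B.prodTranslationActionOver D.hat u K' hcov').aut k).hom ≫ pullback.snd B.X.hom D.hat.X.hom) :=
            (Category.assoc _ _ _).trans (congrArg (fun x => ε' ≫ x) f2).symm
      _ = (ε' ≫ ((B.prodTranslationActionOver D.hat u K' hcov').aut k).hom) ≫ pullback.snd B.X.hom D.hat.X.hom :=
            (Category.assoc _ _ _).symm

/-! ## §2–§3 The normalised `K′`-equivariant structure on `𝒩₁` -/

section Structure

variable [IsReduced D.hat.X.left] [IsLocallyNoetherian D.hat.X.left]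

/-- The data of §3 exists: a `K′`-linearisation of `𝒩₁` for `1 × t_•` restricting along `ε` to the TRIVIAL linearisation of
`ε^*𝒩₁ ≅ 𝒪_Â = (Â → Y)^*𝒪_Y` transported along the rigidification (★ rigid descent along the unit section; each
`(1 × t_k)^*𝒩₁ ≅ 𝒩₁` exists because `K′` lies in the stabiliser). [cite: MumfordAV1970, §8 (pp. 78–80)]
[cite: MumfordFogartyKirwan1994, Ch. 1 §3 Definition 1.6 (p. 30)] -/
theorem exists_poincareStabilizerStructure (hK' : K' ≤ A.poincareStabilizerSubgroup u K hK hcov hG hsm hgc D hfree) :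
    ∃ Φ : (((A.quotientBy u K hcov hG hsm hgc).prodTranslationActionOver D.hat u K' hcov').EquivariantStructure
        (A.poincarePullback u K hK hcov hG hsm hgc D hfree)),
      ∀ k : K', restrictAlong ((A.quotientBy u K hcov hG hsm hgc).prodTranslationActionOver D.hat u K' hcov')
          (D.hat.translationActionOver u K') ((A.quotientBy u K hcov hG hsm hgc).baseChange D.hat.X.hom).unitSection
          (A.translation_comp_unitSection_baseChange u D K' hcov' (A.quotientBy u K hcov hG hsm hgc))
          (A.poincarePullback u K hK hcov hG hsm hgc D hfree) k (Φ.iso k).hom =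
        ((((ActionOver.EquivariantStructure.ofPullback (D.hat.translationActionOver u K') (SheafOfModules.unit _)).ofIso
          (RigidifiedLineBundle.pullbackUnitIso (D.hat.X.hom ≫ u) ≪≫
            (A.poincarePullbackBundle u K hK hcov hG hsm hgc D hfree).rigid.some.symm))).iso k).hom :=
  ((A.quotientBy u K hcov hG hsm hgc).baseChange D.hat.X.hom).exists_equivariantStructure_of_restrictAlong_unitSection
    ((A.quotientBy u K hcov hG hsm hgc).prodTranslationActionOver D.hat u K' hcov') (D.hat.translationActionOver u K')
    (A.translation_comp_unitSection_baseChange u D K' hcov' (A.quotientBy u K hcov hG hsm hgc))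
    (A.poincarePullbackBundle u K hK hcov hG hsm hgc D hfree).hasRank_one
    (fun k => (A.mem_poincareStabilizer_iff u K hK hcov hG hsm hgc D hfree (k : D.hat.Sections)).1 (hK' k.2)) _

/-- **THE NORMALISED `K′`-EQUIVARIANT STRUCTURE ON `𝒩₁ = (π × 1)^*𝒫`** for the action `1 × t_•` of `K′ ≤ Stab(𝒩₁)` on
`B ×_S Â` (`B = A/K`, `Â` reduced and locally Noetherian): the unique `K′`-linearisation of `𝒩₁` whose restriction along the
unit section `ε : Â → B ×_S Â` is the trivial linearisation of `ε^*𝒩₁ ≅ 𝒪_Â` (Mumford's normalisation along `{0} × X`, in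
families).  Its `iso_one_hom` / `iso_mul_hom` are the `hunit` / `hcocycle` of ★ T1 `ActionOver.exists_descent_of_free`.
[cite: MumfordAV1970, §8 (pp. 78–80) and §15 Thm. 1 (p. 143)] [cite: MilneAV2008, I §8 p. 40] -/
def poincareStabilizerStructure (hK' : K' ≤ A.poincareStabilizerSubgroup u K hK hcov hG hsm hgc D hfree) :
    ((A.quotientBy u K hcov hG hsm hgc).prodTranslationActionOver D.hat u K' hcov').EquivariantStructure
      (A.poincarePullback u K hK hcov hG hsm hgc D hfree) :=
  (A.exists_poincareStabilizerStructure u K hK hcov hG hsm hgc D hfree K' hcov' hK').choose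

/-- **Normalisation of `poincareStabilizerStructure`**: its restriction along the unit section `ε` is the trivial
`K′`-linearisation of `ε^*𝒩₁ ≅ 𝒪_Â`. [cite: MumfordAV1970, §8 (pp. 78–80)] -/
theorem poincareStabilizerStructure_restrictAlong (hK' : K' ≤ A.poincareStabilizerSubgroup u K hK hcov hG hsm hgc D hfree) (k : K') :
    restrictAlong ((A.quotientBy u K hcov hG hsm hgc).prodTranslationActionOver D.hat u K' hcov')
        (D.hat.translationActionOver u K') ((A.quotientBy u K hcov hG hsm hgc).baseChange D.hat.X.hom).unitSection
        (A.translation_comp_unitSection_baseChange u D K' hcov' (A.quotientBy u K hcov hG hsm hgc))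
        (A.poincarePullback u K hK hcov hG hsm hgc D hfree) k
        ((A.poincareStabilizerStructure u K hK hcov hG hsm hgc D hfree K' hcov' hK').iso k).hom =
      ((((ActionOver.EquivariantStructure.ofPullback (D.hat.translationActionOver u K') (SheafOfModules.unit _)).ofIso
        (RigidifiedLineBundle.pullbackUnitIso (D.hat.X.hom ≫ u) ≪≫
          (A.poincarePullbackBundle u K hK hcov hG hsm hgc D hfree).rigid.some.symm))).iso k).hom :=
  (A.exists_poincareStabilizerStructure u K hK hcov hG hsm hgc D hfree K' hcov' hK').choose_spec k

/-- **Uniqueness of the normalised structure**: any `K′`-linearisation of `𝒩₁` for `1 × t_•` with the same restriction along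
`ε` has the same structure isomorphisms. [cite: MumfordAV1970, §8 (pp. 78–80)] -/
theorem poincareStabilizerStructure_unique (hK' : K' ≤ A.poincareStabilizerSubgroup u K hK hcov hG hsm hgc D hfree)
    (Φ' : ((A.quotientBy u K hcov hG hsm hgc).prodTranslationActionOver D.hat u K' hcov').EquivariantStructure
      (A.poincarePullback u K hK hcov hG hsm hgc D hfree))
    (h : ∀ k : K', restrictAlong ((A.quotientBy u K hcov hG hsm hgc).prodTranslationActionOver D.hat u K' hcov')
        (D.hat.translationActionOver u K') ((A.quotientBy u K hcov hG hsm hgc).baseChange D.hat.X.hom).unitSection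
        (A.translation_comp_unitSection_baseChange u D K' hcov' (A.quotientBy u K hcov hG hsm hgc))
        (A.poincarePullback u K hK hcov hG hsm hgc D hfree) k (Φ'.iso k).hom =
      ((((ActionOver.EquivariantStructure.ofPullback (D.hat.translationActionOver u K') (SheafOfModules.unit _)).ofIso
        (RigidifiedLineBundle.pullbackUnitIso (D.hat.X.hom ≫ u) ≪≫
          (A.poincarePullbackBundle u K hK hcov hG hsm hgc D hfree).rigid.some.symm))).iso k).hom)
    (k : K') : Φ'.iso k = (A.poincareStabilizerStructure u K hK hcov hG hsm hgc D hfree K' hcov' hK').iso k :=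
  ((A.quotientBy u K hcov hG hsm hgc).baseChange D.hat.X.hom).equivariantStructure_iso_eq_of_restrictAlong_eq
    ((A.quotientBy u K hcov hG hsm hgc).prodTranslationActionOver D.hat u K' hcov') (D.hat.translationActionOver u K')
    (A.translation_comp_unitSection_baseChange u D K' hcov' (A.quotientBy u K hcov hG hsm hgc))
    (A.poincarePullbackBundle u K hK hcov hG hsm hgc D hfree).hasRank_one Φ' _
    (fun k => (h k).trans (A.poincareStabilizerStructure_restrictAlong u K hK hcov hG hsm hgc D hfree K' hcov' hK' k).symm) k

/-- The `hunit` input of ★ T1 for `𝒩₁`, by name. [cite: MumfordFogartyKirwan1994, Ch. 1 §3 Definition 1.6 (p. 30)] -/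
theorem poincareStabilizerStructure_hunit (hK' : K' ≤ A.poincareStabilizerSubgroup u K hK hcov hG hsm hgc D hfree) :
    ((A.poincareStabilizerStructure u K hK hcov hG hsm hgc D hfree K' hcov' hK').iso 1).hom =
      ((Scheme.Modules.pullbackCongr
          ((A.quotientBy u K hcov hG hsm hgc).prodTranslationActionOver D.hat u K' hcov').autHom_one).app _).hom ≫
        ((Scheme.Modules.pullbackId _).app _).hom :=
  (A.poincareStabilizerStructure u K hK hcov hG hsm hgc D hfree K' hcov' hK').iso_one_hom

/-- The `hcocycle` input of ★ T1 for `𝒩₁`, by name. [cite: MumfordFogartyKirwan1994, Ch. 1 §3 Definition 1.6 (p. 30)] -/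
theorem poincareStabilizerStructure_hcocycle (hK' : K' ≤ A.poincareStabilizerSubgroup u K hK hcov hG hsm hgc D hfree) (g h : K') :
    ((A.poincareStabilizerStructure u K hK hcov hG hsm hgc D hfree K' hcov' hK').iso (g * h)).hom =
      ((Scheme.Modules.pullbackCongr
          (((A.quotientBy u K hcov hG hsm hgc).prodTranslationActionOver D.hat u K' hcov').autHom_mul g h)).app _).hom ≫
        ((Scheme.Modules.pullbackComp
            (((A.quotientBy u K hcov hG hsm hgc).prodTranslationActionOver D.hat u K' hcov').autHom h)
            (((A.quotientBy u K hcov hG hsm hgc).prodTranslationActionOver D.hat u K' hcov').autHom g)).app _).inv ≫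
          (Scheme.Modules.pullback
              (((A.quotientBy u K hcov hG hsm hgc).prodTranslationActionOver D.hat u K' hcov').autHom h)).map
              ((A.poincareStabilizerStructure u K hK hcov hG hsm hgc D hfree K' hcov' hK').iso g).hom ≫
            ((A.poincareStabilizerStructure u K hK hcov hG hsm hgc D hfree K' hcov' hK').iso h).hom :=
  (A.poincareStabilizerStructure u K hK hcov hG hsm hgc D hfree K' hcov' hK').iso_mul_hom g h

end Structure

end AbelianSchemeOver

end Literature.AlgebraicGeometry.AbelianSchemes

end
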